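import Summits.Ventures.PercRepro.LemmaC9

/-!
# The abstract Lemma C for classes with at most two varying edges

`LemmaCAbstract` (`LemmaC9.lean`) asks, in every Gladkov setting and for every nested triple
`v ≤ m ≤ u`, that the colourings `φ : u ∖ v → {0,1,2}` of the class, weighted by the kernel
`kerC009` of the cells of the three copies, sum to a nonnegative number.  This file proves it
whenever `u ∖ v` has at most two edges (`lemmaC_of_card_le_two`).

* `|u ∖ v| = 0`: one colouring, `kerC009 (c, c, c) = 0`.
* `|u ∖ v| = 1`: the three colourings are the three positions of the odd copy; the kernel sums to
  `[x = 0 ∧ y = 1] + [y = 0 ∧ x = 1] ≥ 0` pointwise (`kerC009_three_positions`).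
* `|u ∖ v| = 2`, `D = {a, b}`: the nine colourings are parametrised by `(i, j) ∈ Fin 3 × Fin 3`
  (`colourEquiv`), every copy is one of the four configurations `v, v∪a, v∪b, u` (`tripleCopy_eq_cfg`),
  and the sum is a fixed nine-term expression (`classSum2Z`) in the four cell indices, constrained
  by the Gladkov structure along `v ≤ v∪a, v∪b ≤ u` (`Constr`, from `cellOf_top_mono`,
  `cellOf_bot_anti`, `cellOf_cross_mono`; for `m ≤ 1` the kernel is pointwise nonnegative).  The
  four indices are relabelled into `Fin 6` preserving `= 0`, `= 1`, `=` and `<` (`relabel`), after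
  which the inequality is a finite kernel computation (`finite_check`, `decide`).

The tight instances are the patterns `c(v) = B, c(v∪a) = C_i, c(v∪b) = C_j, i ≠ j` and
`c(v∪a) = C_i, c(v∪b) = C_j, c(u) = A`, where the class sum is `0` — the germ of the three-type
difficulty (`proofs/P5-C007-lemmaC.md` §5).

Part A of `LemmaCTwoEdges` (split for the ≤ 400-line lint; proofs byte-identical) — the last part `LemmaCTwoEdges.lean` imports it.
-/

namespace PercRepro

open Finset

/-! ### The integer kernel and the finite check -/

/-- The integer form of `kerC009`. -/
def kerZ (m : ℕ) (s t w : Fin (m + 2)) : ℤ :=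
  (if s = 0 then (if t = 1 then 1 else 0) else 0) - (if s < t ∧ t < w then 1 else 0)

/-- `kerC009` is the cast of `kerZ`. -/
theorem kerC009_eq_kerZ (m : ℕ) (s t w : Fin (m + 2)) : kerC009 m s t w = (kerZ m s t w : ℝ) := by
  unfold kerC009 kerZ
  split_ifs <;> simp

/-- For `m ≤ 1` the kernel is pointwise nonnegative. -/
theorem kerC009_nonneg_of_le_one {m : ℕ} (hm : m ≤ 1) (s t w : Fin (m + 2)) :
    0 ≤ kerC009 m s t w := by
  unfold kerC009
  have hs := s.isLt
  have ht := t.isLt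
  have hw := w.isLt
  by_cases h : s < t ∧ t < w
  · have h' := h
    rw [Fin.lt_def, Fin.lt_def] at h'
    have hs0 : s = 0 := Fin.ext (by simp only [Fin.val_zero]; omega)
    have ht1 : t = 1 := Fin.ext (by rw [Fin.val_one]; omega)
    rw [if_pos hs0, if_pos ht1, if_pos h]
    norm_num
  · rw [if_neg h, sub_zero]
    split_ifs <;> norm_num

/-- Which copy `k` receives a varying edge of colour `i`: a single edge (`dbl = false`) lies in
copy `i` only, a double edge (`dbl = true`) in every copy except `i`. -/
def gets (dbl : Bool) (i k : Fin 3) : Bool := if dbl then decide (i ≠ k) else decide (i = k)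

/-- The index of the configuration `v ∪ (a if pa) ∪ (b if pb)`: `0 = v, 1 = v∪a, 2 = v∪b, 3 = u`. -/
def cfgIdx (pa pb : Bool) : Fin 4 := ⟨(if pa then 1 else 0) + (if pb then 2 else 0), by split_ifs <;> omega⟩

/-- The nine-term class sum of a two-edge class, in terms of the four cell indices
`f : Fin 4 → Fin (m+2)` and the single/double flags `ma`, `mb`. -/
def classSum2Z (m : ℕ) (ma mb : Bool) (f : Fin 4 → Fin (m + 2)) : ℤ :=
    kerZ m (f (cfgIdx (gets ma 0 0) (gets mb 0 0))) (f (cfgIdx (gets ma 0 1) (gets mb 0 1)))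
      (f (cfgIdx (gets ma 0 2) (gets mb 0 2))) +
    kerZ m (f (cfgIdx (gets ma 0 0) (gets mb 1 0))) (f (cfgIdx (gets ma 0 1) (gets mb 1 1)))
      (f (cfgIdx (gets ma 0 2) (gets mb 1 2))) +
    kerZ m (f (cfgIdx (gets ma 0 0) (gets mb 2 0))) (f (cfgIdx (gets ma 0 1) (gets mb 2 1)))
      (f (cfgIdx (gets ma 0 2) (gets mb 2 2))) +
    kerZ m (f (cfgIdx (gets ma 1 0) (gets mb 0 0))) (f (cfgIdx (gets ma 1 1) (gets mb 0 1)))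
      (f (cfgIdx (gets ma 1 2) (gets mb 0 2))) +
    kerZ m (f (cfgIdx (gets ma 1 0) (gets mb 1 0))) (f (cfgIdx (gets ma 1 1) (gets mb 1 1)))
      (f (cfgIdx (gets ma 1 2) (gets mb 1 2))) +
    kerZ m (f (cfgIdx (gets ma 1 0) (gets mb 2 0))) (f (cfgIdx (gets ma 1 1) (gets mb 2 1)))
      (f (cfgIdx (gets ma 1 2) (gets mb 2 2))) +
    kerZ m (f (cfgIdx (gets ma 2 0) (gets mb 0 0))) (f (cfgIdx (gets ma 2 1) (gets mb 0 1)))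
      (f (cfgIdx (gets ma 2 2) (gets mb 0 2))) +
    kerZ m (f (cfgIdx (gets ma 2 0) (gets mb 1 0))) (f (cfgIdx (gets ma 2 1) (gets mb 1 1)))
      (f (cfgIdx (gets ma 2 2) (gets mb 1 2))) +
    kerZ m (f (cfgIdx (gets ma 2 0) (gets mb 2 0))) (f (cfgIdx (gets ma 2 1) (gets mb 2 1)))
      (f (cfgIdx (gets ma 2 2) (gets mb 2 2)))

/-- The Gladkov constraints on the four cells along `v ≤ v∪a, v∪b ≤ u` (`m ≥ 2`):
`A` is an up-set, `B` a down-set, and a crossing cell moves only to itself or to `A`. -/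
def Constr (m : ℕ) (f : Fin 4 → Fin (m + 2)) : Prop :=
  ∀ p q : Fin 4, (p = 0 ∨ q = 3 ∨ p = q) → (f p = 0 → f q = 0) ∧ (f q = 1 → f p = 1) ∧
    (2 ≤ (f p).val → f q = 0 ∨ f q = f p)

/-- The constraint predicate is decidable (a finite conjunction over `Fin 4 × Fin 4`). -/
instance (m : ℕ) (f : Fin 4 → Fin (m + 2)) : Decidable (Constr m f) := by
  unfold Constr
  infer_instance

set_option maxRecDepth 20000 in
/-- **The finite check**: on six relabelled cell values the nine-term sum is nonnegative under
the constraints (`2 · 2 · 6⁴` cases, kernel `decide`). -/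
theorem finite_check : ∀ ma mb : Bool, ∀ g : Fin 4 → Fin (4 + 2), Constr 4 g → 0 ≤ classSum2Z 4 ma mb g := by
  decide

/-! ### Relabelling four cell indices into `Fin 6` -/

section Relabel

variable {m : ℕ} (f : Fin 4 → Fin (m + 2))

/-- The number of indices whose (crossing) value is smaller than `f i`. -/
def rank (i : Fin 4) : ℕ := (univ.filter fun j => 2 ≤ (f j).val ∧ f j < f i).card

/-- `rank f i ≤ 3`. -/
theorem rank_le (i : Fin 4) : rank f i ≤ 3 := by
  unfold rank
  have h : (univ.filter fun j => 2 ≤ (f j).val ∧ f j < f i) ⊆ univ.erase i := by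
    intro j hj
    rw [Finset.mem_filter] at hj
    rw [Finset.mem_erase]
    exact ⟨fun hji => (lt_irrefl _ (hji ▸ hj.2.2)), Finset.mem_univ j⟩
  calc _ ≤ (univ.erase i).card := Finset.card_le_card h
    _ = 3 := by rw [Finset.card_erase_of_mem (Finset.mem_univ i)]; simp

/-- The relabelling: `0 ↦ 0`, `1 ↦ 1`, a crossing value `↦ 2 + rank`. -/
def relabel (i : Fin 4) : Fin (4 + 2) :=
  if f i = 0 then 0 else if f i = 1 then 1 else ⟨2 + rank f i, by have := rank_le f i; omega⟩

/-- Every value is `0`, `1` or crossing (`≥ 2`). -/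
theorem three_cases (i : Fin 4) : f i = 0 ∨ f i = 1 ∨ 2 ≤ (f i).val := by
  rcases Nat.lt_or_ge (f i).val 2 with h | h
  · rcases Nat.lt_or_ge (f i).val 1 with h1 | h1
    · exact Or.inl (Fin.ext (by simp only [Fin.val_zero]; omega))
    · exact Or.inr (Or.inl (Fin.ext (by rw [Fin.val_one]; omega)))
  · exact Or.inr (Or.inr h)

/-- `relabel` fixes the index `0`. -/
theorem relabel_of_eq_zero {i : Fin 4} (h : f i = 0) : relabel f i = 0 := by
  simp [relabel, h]

/-- `relabel` fixes the index `1`. -/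
theorem relabel_of_eq_one {i : Fin 4} (h : f i = 1) : relabel f i = 1 := by
  simp [relabel, h]

/-- A cross index `≥ 2` is sent to `2 + rank`. -/
theorem relabel_of_cross {i : Fin 4} (h : 2 ≤ (f i).val) :
    relabel f i = ⟨2 + rank f i, by have := rank_le f i; omega⟩ := by
  have h0 : f i ≠ 0 := fun e => by rw [e] at h; simp at h
  have h1 : f i ≠ 1 := fun e => by rw [e, Fin.val_one] at h; omega
  simp [relabel, h0, h1]

/-- `relabel f i = 0` exactly when `f i = 0`. -/
theorem relabel_eq_zero_iff (i : Fin 4) : relabel f i = 0 ↔ f i = 0 := by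
  rcases three_cases f i with h | h | h
  · simp [relabel_of_eq_zero f h, h]
  · rw [relabel_of_eq_one f h, h]
    simp
  · rw [relabel_of_cross f h]
    constructor
    · intro e
      rw [Fin.ext_iff] at e
      simp at e
    · intro e
      rw [e] at h
      simp at h

/-- `relabel f i = 1` exactly when `f i = 1`. -/
theorem relabel_eq_one_iff (i : Fin 4) : relabel f i = 1 ↔ f i = 1 := by
  rcases three_cases f i with h | h | h
  · rw [relabel_of_eq_zero f h, h]
    simp
  · simp [relabel_of_eq_one f h, h]
  · rw [relabel_of_cross f h]
    constructor
    · intro e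
      simp only [Fin.ext_iff, Fin.val_one] at e
      omega
    · intro e
      rw [e, Fin.val_one] at h
      omega

/-- Two crossing values compare as their ranks. -/
theorem rank_lt_rank {i j : Fin 4} (hi : 2 ≤ (f i).val) (h : f i < f j) :
    rank f i < rank f j := by
  unfold rank
  apply Finset.card_lt_card
  rw [Finset.ssubset_iff_of_subset]
  · refine ⟨i, ?_, ?_⟩
    · rw [Finset.mem_filter]
      exact ⟨Finset.mem_univ i, hi, h⟩
    · rw [Finset.mem_filter]
      exact fun hh => lt_irrefl _ hh.2.2
  · intro k hk
    rw [Finset.mem_filter] at hk ⊢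
    exact ⟨hk.1, hk.2.1, hk.2.2.trans h⟩

/-- Equal values have equal ranks. -/
theorem rank_eq_rank {i j : Fin 4} (h : f i = f j) : rank f i = rank f j := by
  unfold rank
  rw [h]

/-- The relabelling preserves `<`. -/
theorem relabel_lt_iff (i j : Fin 4) : relabel f i < relabel f j ↔ f i < f j := by
  rcases three_cases f i with hi | hi | hi <;> rcases three_cases f j with hj | hj | hj
  · rw [relabel_of_eq_zero f hi, relabel_of_eq_zero f hj, hi, hj]
    exact iff_of_false (lt_irrefl _) (lt_irrefl _)
  · rw [relabel_of_eq_zero f hi, relabel_of_eq_one f hj, hi, hj]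
    simp
  · rw [relabel_of_eq_zero f hi, relabel_of_cross f hj, hi]
    simp only [Fin.lt_def, Fin.val_zero]
    omega
  · rw [relabel_of_eq_one f hi, relabel_of_eq_zero f hj, hi, hj]
    simp
  · rw [relabel_of_eq_one f hi, relabel_of_eq_one f hj, hi, hj]
    exact iff_of_false (lt_irrefl _) (lt_irrefl _)
  · rw [relabel_of_eq_one f hi, relabel_of_cross f hj, hi]
    simp only [Fin.lt_def, Fin.val_one]
    omega
  · rw [relabel_of_cross f hi, relabel_of_eq_zero f hj, hj]
    simp only [Fin.lt_def, Fin.val_zero]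
    omega
  · rw [relabel_of_cross f hi, relabel_of_eq_one f hj, hj]
    simp only [Fin.lt_def, Fin.val_one]
    omega
  · rw [relabel_of_cross f hi, relabel_of_cross f hj]
    simp only [Fin.lt_def]
    constructor
    · intro h
      rcases lt_trichotomy (f i) (f j) with hlt | heq | hgt
      · exact hlt
      · exfalso
        have := rank_eq_rank f heq
        omega
      · exfalso
        have := rank_lt_rank f hj hgt
        omega
    · intro h
      have := rank_lt_rank f hi h
      omega

/-- The relabelling preserves `=`. -/
theorem relabel_eq_iff (i j : Fin 4) : relabel f i = relabel f j ↔ f i = f j := by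
  constructor
  · intro h
    rcases lt_trichotomy (f i) (f j) with hlt | heq | hgt
    · exfalso
      have := (relabel_lt_iff f i j).2 hlt
      rw [h] at this
      exact lt_irrefl _ this
    · exact heq
    · exfalso
      have := (relabel_lt_iff f j i).2 hgt
      rw [h] at this
      exact lt_irrefl _ this
  · intro h
    rcases lt_trichotomy (relabel f i) (relabel f j) with hlt | heq | hgt
    · exfalso
      have := (relabel_lt_iff f i j).1 hlt
      rw [h] at this
      exact lt_irrefl _ this
    · exact heq
    · exfalso
      have := (relabel_lt_iff f j i).1 hgt
      rw [h] at this
      exact lt_irrefl _ this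

/-- The relabelling preserves "crossing". -/
theorem relabel_cross_iff (i : Fin 4) : 2 ≤ (relabel f i).val ↔ 2 ≤ (f i).val := by
  rcases three_cases f i with h | h | h
  · rw [relabel_of_eq_zero f h, h]
    exact ⟨fun hh => by simp at hh, fun hh => by simp at hh⟩
  · rw [relabel_of_eq_one f h, h]
    exact ⟨fun hh => by simp at hh, fun hh => by simp at hh⟩
  · rw [relabel_of_cross f h]
    exact ⟨fun _ => h, fun _ => by simp⟩

/-- The kernel only sees `= 0`, `= 1` and `<`, so it is invariant under the relabelling. -/
theorem kerZ_relabel (p q r : Fin 4) :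
    kerZ m (f p) (f q) (f r) = kerZ 4 (relabel f p) (relabel f q) (relabel f r) := by
  unfold kerZ
  simp only [relabel_eq_zero_iff, relabel_eq_one_iff, relabel_lt_iff]

/-- The constraints transfer along the relabelling. -/
theorem constr_relabel (h : Constr m f) : Constr 4 (relabel f) := by
  intro p q hpq
  obtain ⟨h0, h1, h2⟩ := h p q hpq
  refine ⟨?_, ?_, ?_⟩
  · intro e
    rw [relabel_eq_zero_iff] at e ⊢
    exact h0 e
  · intro e
    rw [relabel_eq_one_iff] at e ⊢
    exact h1 e
  · intro e
    rw [relabel_cross_iff] at e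
    rw [relabel_eq_zero_iff, relabel_eq_iff]
    exact h2 e

/-- The class sum is invariant under the relabelling. -/
theorem classSum2Z_relabel (ma mb : Bool) :
    classSum2Z m ma mb f = classSum2Z 4 ma mb (relabel f) := by
  unfold classSum2Z
  simp only [kerZ_relabel f]

/-- **The two-edge class sum is nonnegative** under the constraints, for every `m`. -/
theorem classSum2Z_nonneg (ma mb : Bool) (h : Constr m f) : 0 ≤ classSum2Z m ma mb f := by
  rw [classSum2Z_relabel]
  exact finite_check ma mb (relabel f) (constr_relabel f h)

end Relabel

end PercRepro
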